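import Summits.ResolutionOfSingularities.ResolutionOfSingularities.Theorems.FrobeniusLadderFInjectiveMacaulayficationIntrinsicTowerRecipes
import Summits.ResolutionOfSingularities.ResolutionOfSingularities.Theorems.FrobeniusLadderFInjectiveMacaulayficationDimSliceOfCesnavicius
import HarnessLib

/-!
# THE INTRINSIC TOWER PER DIMENSION: on FOURFOLDS the crux ⟸ four published theorems ∧ (TT[c] AT LEVEL 4) for any ONE Sing-supported recipe — in particular
# ⟸ prints ∧ `TauTowerConjecture` restricted to `d = 4`, the level of the whole evidence bed (crux `FInjectiveMacaulayfication` stmt-ResolutionOfSingularities-15315,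
# chain w45a; res-L1-w45a-lead-1 g9, lead's dimension ledger for line v42 «INTRINSIC-CENTRE»; over res-L1-w45a-stub-2's `…IntrinsicTowerRecipes` p632743 and the
# dim-slices `DimSliceOfCesnavicius` / `TrFullStepDoor`)

[OURS · L1 W4.5a] Support file (`--supports stmt-ResolutionOfSingularities-15315 --as helper`); NOT a statement of any manuscript; fact-free; ONE definition
(`TowerTerminatesAt c d` = the `d`-th conjunct of stub-2's `TowerTerminates c`, so that `TowerTerminates c ↔ ∀ d ≥ 4, TowerTerminatesAt c d` is `Iff.rfl`); theorems
CONDITIONAL on the four printed theorems BY NAME and on the chain's CANDIDATE tower statements. AI-written (AI review is weaker than expert review).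

WHY. The kernel bridge of the «TT» programme (`IntrinsicTower.Recipes.localFInjectivizationFibreAdmGe4_of_towerTerminates`) is stated for ALL levels `d ≥ 4` at once, while
(a) the crux has per-dimension slices in the tree — dim ≤ 4 ⟸ prints ∧ F(4) (`DimSliceOfCesnavicius.fInjectiveMacaulayfication_dimLe4_of_cesnaviciusOffClosed_of_F4`), dim ≤ 5 ⟸
prints ∧ F(4) ∧ F(5) ∧ T″(p,4,1) (`TrFullStepDoor.fInjectiveMacaulayfication_dimLe5_of_cesnaviciusOffClosed_of_tStep41_of_F45`) — and (b) the ENTIRE evidence for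
`TauTowerConjecture` lives at `d = 4` (and a little at `d = 5`): res-L1-w45a-idea-1 FB5-r4/r5/r6, rad τ FULL on 21/21 specimens, TT-τ table v1 (98 runs). This file cuts the tower
statement per level and threads it through the slices:
* §1 `TowerTerminatesAt c d`; `towerTerminates_iff_forall_towerTerminatesAt` (`Iff.rfl`); `towerTerminatesAt_of_towerTerminates`.
* §2 ★ `fHalfAt_of_towerTerminatesAt (c) (hc) (d)` : TT[c] at level `d` ⇒ the F-half at level `d` (stub-2's §3 proof, one level at a time: closed fibre closed, misses a preimage of
  the generic point, regular off it; Lemma A-REG `IntrinsicTower.Recipes.exists_fibreCentre_of_towerFull`).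
* §3 ★★ `fInjectiveMacaulayfication_dimLe4_of_prints_of_towerTerminatesAt4 (c) (hc)` : **on schemes of dimension ≤ 4, the crux's ∀-text ⟸ four published theorems ∧ TT[c](4)**;
  ★★ `fInjectiveMacaulayfication_dimLe4_of_prints_of_tauTowerAt4` : the `tauCentre` instance — NO resolution residue at all on fourfolds, ONE killable statement at the bed's level.
* §4 ★ `fInjectiveMacaulayfication_dimLe5_of_prints_of_towerTerminatesAt45_of_tStep41` : dim ≤ 5 ⟸ prints ∧ TT[c](4) ∧ TT[c](5) ∧ T″(p,4,1); `tauCentre` instance.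
HONEST CAVEATS: conditional results; TT[c](4) is kernel-STRONGER than F(4) (a canonical centre and every admissible first floor incl. `Spec 𝒪_{X,x}` itself); `TauTowerConjecture`
is OURS, a candidate under live attack (K-TT test of record: res-L1-w45a-tri-2 kit j307835; adversarial (B5″) runs by idea-1 g22); the N-recipe twin is REFUTED BY EVIDENCE
(plan-1 R19.7) and is not used here; FULL ⊋ F-rational (not rung 15317); nothing of the crux is proved.
[folklore assembly; cite: Temkin2008, Lemma 2.1.4, Prop. 2.3.4] [cite: StacksProject, Tag 080B; Tag 02OS] [cite: CossartPiltant2019, Thm. 1.1 (i)(ii); Prop. 4.4]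
[cite: Cesnavicius2021, Thm. 5.3] [cite: RaynaudGruson1971, Thm. 5.2.2]
-/

-- single-problem summit: the doubled namespace component is forced
set_option linter.dupNamespace false

noncomputable section

open AlgebraicGeometry CategoryTheory CategoryTheory.Limits Literature.AlgebraicGeometry.Resolution TopologicalSpace IsLocalRing

namespace Summit.ResolutionOfSingularities.ResolutionOfSingularities.Theorems.FInjectiveMacaulayfication.IntrinsicTower.DimSlice

open Summit.ResolutionOfSingularities.ResolutionOfSingularities.Theorems.FInjectiveMacaulayfication
open SliceableCentre IntrinsicTower IntrinsicTower.Recipes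

/-! ## §1 The tower statement per level -/

/-- [OURS · CANDIDATE statement shape, KILLABLE per recipe and per level] **(TT[c] AT LEVEL `d`)**: the `d`-th conjunct of `IntrinsicTower.Recipes.TowerTerminates c` — the
F-half's binders VERBATIM with `ringKrullDim 𝒪_{X,x} = d`, conclusion `∃ n, RecipeTowerFull c p n S′`. -/
def TowerTerminatesAt (c : CentreRecipe) (d : ℕ) : Prop :=
  ∀ (p : ℕ), p.Prime → ∀ (k : Type) [Field k] [CharP k p]
    (X : Scheme.{0}) (f : X ⟶ Spec (.of k)),
      IsSeparated f → LocallyOfFiniteType f → QuasiCompact f → IsIntegral X →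
  ∀ x : X, IsClosed ({x} : Set X) → x ∉ Scheme.regularLocus X → ringKrullDim (X.presheaf.stalk x) = d →
  ∀ (S' : Scheme.{0}) (g : S' ⟶ Spec (X.presheaf.stalk x)) (I : (Spec (X.presheaf.stalk x)).IdealSheafData),
    I ≠ ⊥ → (I.support : Set (Spec (X.presheaf.stalk x))) ⊆ (Scheme.regularLocus (Spec (X.presheaf.stalk x)))ᶜ → IsBlowup g I →
    (∀ s : S', g.base s ≠ closedPoint (X.presheaf.stalk x) → s ∈ Scheme.regularLocus S') →
    (∀ s : S', CMCl (S'.presheaf.stalk s)) →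
    ∃ n : ℕ, RecipeTowerFull c p n S'

/-- `TowerTerminates c` IS the conjunction of its levels `d ≥ 4` (definitional). [OURS] -/
theorem towerTerminates_iff_forall_towerTerminatesAt (c : CentreRecipe) :
    TowerTerminates c ↔ ∀ d : ℕ, 4 ≤ d → TowerTerminatesAt c d := Iff.rfl

/-- One level out of the full statement. [OURS] -/
theorem towerTerminatesAt_of_towerTerminates {c : CentreRecipe} (h : TowerTerminates c) {d : ℕ} (hd : 4 ≤ d) : TowerTerminatesAt c d :=
  (towerTerminates_iff_forall_towerTerminatesAt c).mp h d hd

/-! ## §2 TT[c] at level `d` ⇒ the F-half at level `d` -/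

/-- **TT[c](d) ⇒ F(d)** for every Sing-supported recipe `c` and every level `d`: the F-half's conclusion at a point of local dimension `d` from the termination of the
`c`-tower of its admissible Cohen–Macaulay first floors (res-L1-w45a-stub-2's `localFInjectivizationFibreAdmGe4_of_towerTerminates`, one level at a time; Lemma A-REG
`IntrinsicTower.Recipes.exists_fibreCentre_of_towerFull` with `F` := the closed fibre). [folklore assembly; OURS · conditional] [cite: Temkin2008, Lemma 2.1.4]
[cite: StacksProject, Tag 080B; Tag 02OS] -/
theorem fHalfAt_of_towerTerminatesAt (c : CentreRecipe) (hc : SingSupported c) (d : ℕ) (hT : TowerTerminatesAt c d) :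
    ∀ (p : ℕ), p.Prime → ∀ (k : Type) [Field k] [CharP k p]
    (X : Scheme.{0}) (f : X ⟶ Spec (.of k)),
      IsSeparated f → LocallyOfFiniteType f → QuasiCompact f → IsIntegral X →
      ∀ x : X, IsClosed ({x} : Set X) → x ∉ Scheme.regularLocus X → ringKrullDim (X.presheaf.stalk x) = d →
      ∀ (S' : Scheme.{0}) (g : S' ⟶ Spec (X.presheaf.stalk x)) (I : (Spec (X.presheaf.stalk x)).IdealSheafData),
        I ≠ ⊥ → (I.support : Set (Spec (X.presheaf.stalk x))) ⊆ (Scheme.regularLocus (Spec (X.presheaf.stalk x)))ᶜ → IsBlowup g I →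
        (∀ s : S', g.base s ≠ closedPoint (X.presheaf.stalk x) → s ∈ Scheme.regularLocus S') →
        (∀ s : S', CMCl (S'.presheaf.stalk s)) →
        ∃ 𝓚 : S'.IdealSheafData, 𝓚 ≠ ⊥ ∧ (∀ s ∈ (𝓚.support : Set S'), g.base s = closedPoint (X.presheaf.stalk x)) ∧
          ∀ (S'' : Scheme.{0}) (π : S'' ⟶ S'), IsBlowup π 𝓚 → ∀ s : S'', FullCl p (S''.presheaf.stalk s) := by
  intro p hp k _ _ X f hsep hft hqc hint x hxcl hxs hx S' g I hI hIadm hg hreg hcm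
  classical
  haveI : IsLocallyNoetherian X := LocallyOfFiniteType.isLocallyNoetherian f
  haveI : IsIntegral S' := hg.isIntegral hI
  haveI : IsProper g := hg.isProper
  haveI : IsLocallyNoetherian S' := LocallyOfFiniteType.isLocallyNoetherian g
  haveI : CompactSpace S' := QuasiCompact.compactSpace_of_compactSpace g
  haveI : IsNoetherian S' := {}
  obtain ⟨n, hn⟩ := hT p hp k X f hsep hft hqc hint x hxcl hxs hx S' g I hI hIadm hg hreg hcm
  -- the closed fibre
  let F : Set S' := {s | g.base s = closedPoint (X.presheaf.stalk x)}
  have hFcl : IsClosed F := by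
    have hcp : IsClosed ({closedPoint (X.presheaf.stalk x)} : Set (Spec (X.presheaf.stalk x))) :=
      (PrimeSpectrum.isClosed_singleton_iff_isMaximal _).mpr (IsLocalRing.maximalIdeal.isMaximal _)
    exact hcp.preimage g.continuous
  -- the generic point of `Spec 𝒪_{X,x}` is regular, off `supp I`, and not the closed point
  have hηreg : genericPoint (Spec (X.presheaf.stalk x)) ∈ Scheme.regularLocus (Spec (X.presheaf.stalk x)) :=
    genericPoint_mem_regularLocus _
  have hηI : genericPoint (Spec (X.presheaf.stalk x)) ∉ (I.support : Set (Spec (X.presheaf.stalk x))) := fun h => hIadm h hηreg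
  have hηne : genericPoint (Spec (X.presheaf.stalk x)) ≠ closedPoint (X.presheaf.stalk x) := by
    intro hη
    apply hxs
    haveI : Flat (X.fromSpecStalk x) := flat_fromSpecStalk X x
    have h := (mem_regularLocus_iff_of_flat_of_isPreimmersion (X.fromSpecStalk x) (closedPoint (X.presheaf.stalk x))).mp (hη ▸ hηreg)
    rwa [Scheme.fromSpecStalk_closedPoint] at h
  -- `F` misses a point: a preimage of the generic point
  have hne : ∃ s : S', s ∉ F := by
    haveI := hg.isIso_compl
    obtain ⟨s, hs⟩ := RegularBlowupModelDim2.exists_preimage_of_isIso_morphismRestrict g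
      ⟨(I.support : Set (Spec (X.presheaf.stalk x)))ᶜ, I.support.isClosed.isOpen_compl⟩ _ hηI
    exact ⟨s, fun h => hηne (hs ▸ h)⟩
  exact Recipes.exists_fibreCentre_of_towerFull c hc p n S' F hFcl hne (fun s hs => hreg s hs) hn

/-! ## §3 Dimension ≤ 4: the crux from the prints and ONE killable statement at the bed's level -/

/-- ★★ **ON SCHEMES OF DIMENSION ≤ 4 the crux's ∀-text ⟸ FOUR PUBLISHED THEOREMS {CP 2019 Thm 1.1, R–G 081R, CP 2019 Prop 4.4, Česnavičius 2021 Thm 5.3} ∧ TT[c] AT LEVEL 4**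
for any ONE Sing-supported recipe `c` — no resolution residue on fourfolds (`DimSliceOfCesnavicius.fInjectiveMacaulayfication_dimLe4_of_cesnaviciusOffClosed_of_F4` + §2).
[OURS · conditional-result] [cite: Cesnavicius2021, Thm. 5.3] [cite: CossartPiltant2019, Thm. 1.1 (i)(ii); Prop. 4.4] [cite: RaynaudGruson1971, Thm. 5.2.2] [cite: Temkin2008, Prop. 2.3.4] -/
theorem fInjectiveMacaulayfication_dimLe4_of_prints_of_towerTerminatesAt4 (c : CentreRecipe) (hc : SingSupported c)
    (hG : CossartPiltant2019General.{0}) (h081R : Stacks081R.{0}) (hP : CossartPiltant2019Principalization.{0})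
    (hM : CesnaviciusBlowupMacaulayficationOffClosed.{0}) (hT4 : TowerTerminatesAt c 4) :
    ∀ p : ℕ, p.Prime → ∀ (k : Type) [Field k] [CharP k p] (X : Scheme.{0}) (f : X ⟶ Spec (.of k)),
      IsSeparated f → LocallyOfFiniteType f → QuasiCompact f → IsReduced X → topologicalKrullDim X ≤ 4 →
      ∃ (X' : Scheme.{0}) (π : X' ⟶ X), IsProper π ∧ IsBirational π ∧ ∀ x : X',
        IsDomain (X'.presheaf.stalk x) ∧ ∀ d : ℕ, ringKrullDim (X'.presheaf.stalk x) = d →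
          ∀ s : Fin d → X'.presheaf.stalk x, (Ideal.span (Set.range s)).radical.IsMaximal →
            RingTheory.Sequence.IsWeaklyRegular (X'.presheaf.stalk x) (List.ofFn s) ∧
            ∀ y : X'.presheaf.stalk x, (∃ e : ℕ, y ^ p ^ e ∈ Ideal.span
              ((fun z : X'.presheaf.stalk x => z ^ p ^ e) ''
                (Ideal.span (Set.range s) : Set (X'.presheaf.stalk x)))) →
              y ∈ Ideal.span (Set.range s) :=
  DimSliceOfCesnavicius.fInjectiveMacaulayfication_dimLe4_of_cesnaviciusOffClosed_of_F4 hG h081R hP hM (fHalfAt_of_towerTerminatesAt c hc 4 hT4)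

/-- ★★ **ON FOURFOLDS: crux ⟸ four published theorems ∧ `TauTowerConjecture` AT LEVEL 4** (the rad-τ recipe of record; the level at which ALL of the chain's tower evidence lives).
[OURS · conditional-result] [cite: Cesnavicius2021, Thm. 5.3] [cite: CossartPiltant2019, Thm. 1.1 (i)(ii); Prop. 4.4] [cite: Temkin2008, Prop. 2.3.4] -/
theorem fInjectiveMacaulayfication_dimLe4_of_prints_of_tauTowerAt4
    (hG : CossartPiltant2019General.{0}) (h081R : Stacks081R.{0}) (hP : CossartPiltant2019Principalization.{0})
    (hM : CesnaviciusBlowupMacaulayficationOffClosed.{0}) (hT4 : TowerTerminatesAt tauCentre 4) :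
    ∀ p : ℕ, p.Prime → ∀ (k : Type) [Field k] [CharP k p] (X : Scheme.{0}) (f : X ⟶ Spec (.of k)),
      IsSeparated f → LocallyOfFiniteType f → QuasiCompact f → IsReduced X → topologicalKrullDim X ≤ 4 →
      ∃ (X' : Scheme.{0}) (π : X' ⟶ X), IsProper π ∧ IsBirational π ∧ ∀ x : X',
        IsDomain (X'.presheaf.stalk x) ∧ ∀ d : ℕ, ringKrullDim (X'.presheaf.stalk x) = d →
          ∀ s : Fin d → X'.presheaf.stalk x, (Ideal.span (Set.range s)).radical.IsMaximal →
            RingTheory.Sequence.IsWeaklyRegular (X'.presheaf.stalk x) (List.ofFn s) ∧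
            ∀ y : X'.presheaf.stalk x, (∃ e : ℕ, y ^ p ^ e ∈ Ideal.span
              ((fun z : X'.presheaf.stalk x => z ^ p ^ e) ''
                (Ideal.span (Set.range s) : Set (X'.presheaf.stalk x)))) →
              y ∈ Ideal.span (Set.range s) :=
  fInjectiveMacaulayfication_dimLe4_of_prints_of_towerTerminatesAt4 tauCentre singSupported_tauCentre hG h081R hP hM hT4

/-- The same from the full conjecture of record (level 4 out of `TauTowerConjecture`). [OURS · conditional-result] -/
theorem fInjectiveMacaulayfication_dimLe4_of_prints_of_tauTower
    (hG : CossartPiltant2019General.{0}) (h081R : Stacks081R.{0}) (hP : CossartPiltant2019Principalization.{0})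
    (hM : CesnaviciusBlowupMacaulayficationOffClosed.{0}) (hTT : TauTowerConjecture) :
    ∀ p : ℕ, p.Prime → ∀ (k : Type) [Field k] [CharP k p] (X : Scheme.{0}) (f : X ⟶ Spec (.of k)),
      IsSeparated f → LocallyOfFiniteType f → QuasiCompact f → IsReduced X → topologicalKrullDim X ≤ 4 →
      ∃ (X' : Scheme.{0}) (π : X' ⟶ X), IsProper π ∧ IsBirational π ∧ ∀ x : X',
        IsDomain (X'.presheaf.stalk x) ∧ ∀ d : ℕ, ringKrullDim (X'.presheaf.stalk x) = d →
          ∀ s : Fin d → X'.presheaf.stalk x, (Ideal.span (Set.range s)).radical.IsMaximal →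
            RingTheory.Sequence.IsWeaklyRegular (X'.presheaf.stalk x) (List.ofFn s) ∧
            ∀ y : X'.presheaf.stalk x, (∃ e : ℕ, y ^ p ^ e ∈ Ideal.span
              ((fun z : X'.presheaf.stalk x => z ^ p ^ e) ''
                (Ideal.span (Set.range s) : Set (X'.presheaf.stalk x)))) →
              y ∈ Ideal.span (Set.range s) :=
  fInjectiveMacaulayfication_dimLe4_of_prints_of_tauTowerAt4 hG h081R hP hM (towerTerminatesAt_of_towerTerminates hTT le_rfl)

/-! ## §4 Dimension ≤ 5 -/

/-- ★ **ON SCHEMES OF DIMENSION ≤ 5 the crux's ∀-text ⟸ four published theorems ∧ TT[c](4) ∧ TT[c](5) ∧ T″(p,4,1)** for any ONE Sing-supported recipe `c`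
(`TrFullStepDoor.fInjectiveMacaulayfication_dimLe5_of_cesnaviciusOffClosed_of_tStep41_of_F45` + §2 twice). [OURS · conditional-result] [cite: Cesnavicius2021, Thm. 5.3]
[cite: CossartPiltant2019, Thm. 1.1 (i)(ii); Prop. 4.4] [cite: Temkin2008, Prop. 2.3.4] -/
theorem fInjectiveMacaulayfication_dimLe5_of_prints_of_towerTerminatesAt45_of_tStep41 (c : CentreRecipe) (hc : SingSupported c)
    (hG : CossartPiltant2019General.{0}) (h081R : Stacks081R.{0}) (hP : CossartPiltant2019Principalization.{0})
    (hM : CesnaviciusBlowupMacaulayficationOffClosed.{0})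
    (hT4 : TowerTerminatesAt c 4) (hT5 : TowerTerminatesAt c 5)
    (hT41 : ∀ p : ℕ, p.Prime → TrFullStep.LocalRegularizationFibreFullTr p 4 1) :
    ∀ p : ℕ, p.Prime → ∀ (k : Type) [Field k] [CharP k p] (X : Scheme.{0}) (f : X ⟶ Spec (.of k)),
      IsSeparated f → LocallyOfFiniteType f → QuasiCompact f → IsReduced X → topologicalKrullDim X ≤ 5 →
      ∃ (X' : Scheme.{0}) (π : X' ⟶ X), IsProper π ∧ IsBirational π ∧ ∀ x : X',
        IsDomain (X'.presheaf.stalk x) ∧ ∀ d : ℕ, ringKrullDim (X'.presheaf.stalk x) = d →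
          ∀ s : Fin d → X'.presheaf.stalk x, (Ideal.span (Set.range s)).radical.IsMaximal →
            RingTheory.Sequence.IsWeaklyRegular (X'.presheaf.stalk x) (List.ofFn s) ∧
            ∀ y : X'.presheaf.stalk x, (∃ e : ℕ, y ^ p ^ e ∈ Ideal.span
              ((fun z : X'.presheaf.stalk x => z ^ p ^ e) ''
                (Ideal.span (Set.range s) : Set (X'.presheaf.stalk x)))) →
              y ∈ Ideal.span (Set.range s) :=
  TrFullStepDoor.fInjectiveMacaulayfication_dimLe5_of_cesnaviciusOffClosed_of_tStep41_of_F45 hG h081R hP hM hT41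
    (fHalfAt_of_towerTerminatesAt c hc 4 hT4) (fHalfAt_of_towerTerminatesAt c hc 5 hT5)

/-- ★ **ON 5-FOLDS: crux ⟸ four published theorems ∧ `TauTowerConjecture` at levels 4 and 5 ∧ T″(p,4,1).** [OURS · conditional-result] [cite: Cesnavicius2021, Thm. 5.3]
[cite: CossartPiltant2019, Thm. 1.1 (i)(ii); Prop. 4.4] [cite: Temkin2008, Prop. 2.3.4] -/
theorem fInjectiveMacaulayfication_dimLe5_of_prints_of_tauTowerAt45_of_tStep41
    (hG : CossartPiltant2019General.{0}) (h081R : Stacks081R.{0}) (hP : CossartPiltant2019Principalization.{0})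
    (hM : CesnaviciusBlowupMacaulayficationOffClosed.{0})
    (hT4 : TowerTerminatesAt tauCentre 4) (hT5 : TowerTerminatesAt tauCentre 5)
    (hT41 : ∀ p : ℕ, p.Prime → TrFullStep.LocalRegularizationFibreFullTr p 4 1) :
    ∀ p : ℕ, p.Prime → ∀ (k : Type) [Field k] [CharP k p] (X : Scheme.{0}) (f : X ⟶ Spec (.of k)),
      IsSeparated f → LocallyOfFiniteType f → QuasiCompact f → IsReduced X → topologicalKrullDim X ≤ 5 →
      ∃ (X' : Scheme.{0}) (π : X' ⟶ X), IsProper π ∧ IsBirational π ∧ ∀ x : X',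
        IsDomain (X'.presheaf.stalk x) ∧ ∀ d : ℕ, ringKrullDim (X'.presheaf.stalk x) = d →
          ∀ s : Fin d → X'.presheaf.stalk x, (Ideal.span (Set.range s)).radical.IsMaximal →
            RingTheory.Sequence.IsWeaklyRegular (X'.presheaf.stalk x) (List.ofFn s) ∧
            ∀ y : X'.presheaf.stalk x, (∃ e : ℕ, y ^ p ^ e ∈ Ideal.span
              ((fun z : X'.presheaf.stalk x => z ^ p ^ e) ''
                (Ideal.span (Set.range s) : Set (X'.presheaf.stalk x)))) →
              y ∈ Ideal.span (Set.range s) :=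
  fInjectiveMacaulayfication_dimLe5_of_prints_of_towerTerminatesAt45_of_tStep41 tauCentre singSupported_tauCentre hG h081R hP hM hT4 hT5 hT41

end Summit.ResolutionOfSingularities.ResolutionOfSingularities.Theorems.FInjectiveMacaulayfication.IntrinsicTower.DimSlice

end
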